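import Literature.Probability.RandomPlanarGeometry.RestrictionExitTime
import Literature.Probability.RandomPlanarGeometry.ConformalRestrictionLeaf
import Literature.Probability.RandomPlanarGeometry.SmoothArcApproximation
import Literature.Probability.RandomPlanarGeometry.SLETraceMeasurable
import HarnessLib

/-!
# [LSW] Theorem 6.1 and its transposition with Lemma 6.2 PROVED (simple-curve form)

Proof-only re-threading. `RestrictionExitTime` proves [LSW] Lemma 6.2 for chains from the
origin generated by a simple curve (`Loewner.restrictionDeriv_exitTime_gt_simple_holds`), which
is all that the proof of [LSW] Thm. 6.1 for SLE_{8/3} uses (the SLE_{8/3} chain is generated by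
its simple trace, Rohde–Schramm). This file repeats the consumers of the named fact
`Loewner.restrictionDeriv_exitTime_gt` (Lemma 6.2 for ALL driving functions) —
`sle_restrictionDeriv_frequently_gt_of_isPlusHull` (`SLERestrictionLemmas`), the reflected minus
case (`LoewnerReflection`), the smooth and one-sided cases of Thm. 6.1 (`SLERestrictionSmooth`),
the two-sided assembly (`SLERestrictionSlidHull`) and the leaf assembly of
`IsSLELaw.hullRestriction_eightThirds` (`HullRestrictionSLELeaf`) — with that hypothesis
DISCHARGED (primed names, proofs otherwise verbatim):

* `Literature.Probability.RandomPlanarGeometry.sle_restriction_eightThirds_of_printed_facts'` —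
  [LSW] Thm. 6.1 from Prop. 5.2/5.3 (`hM`), Lemma 6.3 (`h63`) and the Rohde–Schramm facts only;
* `Literature.Probability.RandomPlanarGeometry.IsSLELaw.hullRestriction_eightThirds_of_leaf_facts'` —
  the transposed Thm. 6.1 from SIX named facts (`hasSLETrace_eight`, `hasSLETrace_of_ne_eight`,
  `tendsto_norm_sleTrace_atTop`, `ae_isSimpleTrace_sleTrace_of_le_four (8/3)`,
  `sle_exists_isRestrictionMartingale`, `IsSmoothHull.restrictionDerivVanishesAtHit`).

* G. F. Lawler, O. Schramm, W. Werner, *Conformal restriction: the chordal case*, J. Amer. Math.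
  Soc. **16** (2003), arXiv:math/0209343, Thm. 6.1, Lemma 6.2. [LawlerSchrammWerner2003Restriction]
-/

noncomputable section

open Set Filter Topology MeasureTheory Metric Complex
open UpperHalfPlane (upperHalfPlaneSet isOpen_upperHalfPlaneSet)
open scoped NNReal ENNReal ComplexConjugate

namespace Literature.Probability.RandomPlanarGeometry

/-! ### Reflection: Lemma 6.2 (simple-curve form) for `A ∈ 𝒬₋` -/

namespace Loewner

variable {W : ℝ≥0 → ℝ} {γ : ℝ≥0 → ℂ} {A : Set ℂ}

/-- A simple trace reflects to a simple trace (`z ↦ −z̄` is injective and preserves `im`).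
[folklore] -/
theorem IsSimpleTrace.neg_conj (hs : IsSimpleTrace γ) : IsSimpleTrace fun t ↦ -conj (γ t) := by
  refine ⟨fun a b hab ↦ hs.1 ?_, fun t ht ↦ by simpa using hs.2 t ht⟩
  have h := congrArg (fun z : ℂ ↦ -conj z) hab
  simpa using h

/-- **Lemma 6.2 (simple-curve form) for `A ∈ 𝒬₋`, by the reflection `σ`** — as
`restrictionDeriv_exitTime_gt_of_isMinusHull` (`LoewnerReflection`), with the printed Lemma 6.2
replaced by its proved simple-curve form for the reflected chain (driving function `−W`, curve
`σ ∘ γ`, hull `σ(A) ∈ 𝒬₊`). [cite: LawlerSchrammWerner2003Restriction, Lemma 6.2 and proof of Thm. 6.1 ("By symmetry")] -/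
theorem restrictionDeriv_exitTime_gt_of_isMinusHull_simple (hW : Continuous W) (hW0 : W 0 = 0)
    (hγ : IsGeneratedByCurve W γ) (hs : IsSimpleTrace γ) (hA : IsMinusHull A)
    (hdisj : ∀ t, Disjoint (closedHull W t) A) {ε : ℝ} (hε : 0 < ε) :
    ∃ r₀ : ℝ, ∀ r : ℝ, r₀ ≤ r → ∀ t : ℝ≥0, IsExitTime W r t →
      ∀ (Ψ : ConformalEquiv (upperHalfPlaneSet \ slidHull W A t) upperHalfPlaneSet) (e : ℝ),
        IsRestrictionMap (slidHull W A t) Ψ → HasRestrictionDeriv (slidHull W A t) Ψ e →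
          1 - ε < e := by
  have hdisj' : ∀ t, Disjoint (closedHull (fun s ↦ -W s) t) (imagAxisRefl '' A) := fun t ↦ by
    rw [closedHull_imagAxisRefl]
    exact (disjoint_image_iff imagAxisRefl.injective).2 (hdisj t)
  obtain ⟨r₀, hr₀⟩ := restrictionDeriv_exitTime_gt_simple_holds hW.neg (by simp [hW0]) hγ.neg_conj
    hs.neg_conj hA.image_imagAxisRefl hdisj' ε hε
  refine ⟨r₀, fun r hr t ht Ψ e hΨ he ↦ ?_⟩
  obtain ⟨Ψ', hΨ', he'⟩ :=
    exists_restrictionData_of_image (slidHull_imagAxisRefl hW A t).symm Ψ hΨ he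
  exact hr₀ r hr t (isExitTime_neg_iff.2 ht) Ψ' e hΨ' he'

end Loewner

/-! ### [LSW] Lemma 6.2 for SLE_{8/3} (one-sided hulls), without the named fact -/

section SLE

variable {A : Set ℂ}

/-- **[LSW] Lemma 6.2 for SLE_{8/3} and `A ∈ 𝒬₊`** — as `sle_restrictionDeriv_frequently_gt_of_isPlusHull`
(`SLERestrictionLemmas`), with the named fact (Lemma 6.2 for all driving functions) replaced by its
PROVED simple-curve form `Loewner.restrictionDeriv_exitTime_gt_simple_holds`, which applies on the
almost sure event where the SLE_{8/3} chain is generated by its simple trace.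
[cite: LawlerSchrammWerner2003Restriction, Lemma 6.2 and proof of Thm. 6.1 (§6)] -/
theorem sle_restrictionDeriv_frequently_gt_of_isPlusHull'
    (hgen : HasSLETrace ((8 : ℝ≥0) / 3))
    (h₆ : RandomPlanarGeometry.ae_isSimpleTrace_sleTrace_of_le_four (κ := (8 : ℝ≥0) / 3))
    (htr : tendsto_norm_sleTrace_atTop) (hswallow : sle_swallowingTime_ofReal_eq_firstHit)
    (hA : IsPlusHull A) : sle_restrictionDeriv_frequently_gt A := by
  have hκ0 : (0 : ℝ≥0) < 8 / 3 := by positivity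
  have hκ4 : (8 : ℝ≥0) / 3 ≤ 4 := by
    rw [div_le_iff₀ (by norm_num : (0 : ℝ≥0) < 3)]
    norm_num
  filter_upwards [ae_isGeneratedByCurve_sleTrace hgen, h₆ hκ0 hκ4, htr hκ0] with ω hgenω hsω htrω
    hT ε hε
  have hdisj : ∀ t, Disjoint (Loewner.closedHull (sleDriving ((8 : ℝ≥0) / 3) ω) t) A :=
    disjoint_closedHull hswallow hgenω hsω (firstHit_eq_top_iff_disjoint.1 hT)
  obtain ⟨r₀, hr₀⟩ := Loewner.restrictionDeriv_exitTime_gt_simple_holds (continuous_sleDriving _ ω)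
    (sleDriving_zero _ ω) hgenω hsω hA hdisj ε hε
  rw [frequently_atTop]
  intro a
  obtain ⟨r, hr, t, hat, ht⟩ := exists_isExitTime_ge hswallow hgenω hsω htrω a r₀
  exact ⟨t, hat, hr₀ r hr t ht⟩


/-- **[LSW] Lemma 6.2 for SLE_{8/3} and `A ∈ 𝒬₋`** — as `sle_restrictionDeriv_frequently_gt_of_isMinusHull`
(`LoewnerReflection`), from the proved reflected simple-curve form
`Loewner.restrictionDeriv_exitTime_gt_of_isMinusHull_simple`. [cite: LawlerSchrammWerner2003Restriction, Lemma 6.2 and proof of Thm. 6.1 (§6)] -/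
theorem sle_restrictionDeriv_frequently_gt_of_isMinusHull'
    (hgen : HasSLETrace ((8 : ℝ≥0) / 3))
    (h₆ : RandomPlanarGeometry.ae_isSimpleTrace_sleTrace_of_le_four (κ := (8 : ℝ≥0) / 3))
    (htr : tendsto_norm_sleTrace_atTop) (hswallow : sle_swallowingTime_ofReal_eq_firstHit)
    (hA : IsMinusHull A) : sle_restrictionDeriv_frequently_gt A := by
  have hκ0 : (0 : ℝ≥0) < 8 / 3 := by positivity
  have hκ4 : (8 : ℝ≥0) / 3 ≤ 4 := by
    rw [div_le_iff₀ (by norm_num : (0 : ℝ≥0) < 3)]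
    norm_num
  filter_upwards [ae_isGeneratedByCurve_sleTrace hgen, h₆ hκ0 hκ4, htr hκ0] with ω hgenω hsω htrω
    hT ε hε
  have hdisj : ∀ t, Disjoint (Loewner.closedHull (sleDriving ((8 : ℝ≥0) / 3) ω) t) A :=
    disjoint_closedHull hswallow hgenω hsω (firstHit_eq_top_iff_disjoint.1 hT)
  obtain ⟨r₀, hr₀⟩ := Loewner.restrictionDeriv_exitTime_gt_of_isMinusHull_simple
    (continuous_sleDriving _ ω) (sleDriving_zero _ ω) hgenω hsω hA hdisj hε
  rw [frequently_atTop]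
  intro a
  obtain ⟨r, hr, t, hat, ht⟩ := exists_isExitTime_ge hswallow hgenω hsω htrω a r₀
  exact ⟨t, hat, hr₀ r hr t ht⟩

/-- **[LSW] Lemma 6.2 for SLE_{8/3} and `A ∈ 𝒬₊ ∪ 𝒬₋`**, without the named fact — as
`sle_restrictionDeriv_frequently_gt_of_isPlusHull_or_isMinusHull` (`LoewnerReflection`).
[cite: LawlerSchrammWerner2003Restriction, Lemma 6.2 and proof of Thm. 6.1 (§6)] -/
theorem sle_restrictionDeriv_frequently_gt_of_isPlusHull_or_isMinusHull'
    (hgen : HasSLETrace ((8 : ℝ≥0) / 3))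
    (h₆ : RandomPlanarGeometry.ae_isSimpleTrace_sleTrace_of_le_four (κ := (8 : ℝ≥0) / 3))
    (htr : tendsto_norm_sleTrace_atTop) (hswallow : sle_swallowingTime_ofReal_eq_firstHit)
    (hA : IsPlusHull A ∨ IsMinusHull A) : sle_restrictionDeriv_frequently_gt A :=
  hA.elim (sle_restrictionDeriv_frequently_gt_of_isPlusHull' hgen h₆ htr hswallow)
    (sle_restrictionDeriv_frequently_gt_of_isMinusHull' hgen h₆ htr hswallow)


end SLE

/-! ### [LSW] Thm. 6.1 for smooth and one-sided hulls, without Lemma 6.2 as a hypothesis -/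

section Smooth

variable {A : Set ℂ}

/-- **[LSW] Thm. 6.1 for a smooth hull `A ∈ 𝒬₊ ∪ 𝒬₋`** — as `sle_measure_disjoint_eq_of_isSmoothHull`
(`SLERestrictionSmooth`), with Lemma 6.2 supplied by its proof (simple-curve form); the remaining
named inputs are Prop. 5.2/5.3 (`hM`), Lemma 6.3 (`h63`) and the Rohde–Schramm facts.
[cite: LawlerSchrammWerner2003Restriction, Thm. 6.1 and its proof (§6), smooth one-sided case] -/
theorem sle_measure_disjoint_eq_of_isSmoothHull' [Fact Process.isProjectiveLimit_preWienerMeasure]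
    (huniq : IsStarHull.existsUnique_isRestrictionMap) (hM : sle_exists_isRestrictionMartingale)
    (h63 : IsSmoothHull.restrictionDerivVanishesAtHit)
    (hgen : HasSLETrace ((8 : ℝ≥0) / 3))
    (h₆ : RandomPlanarGeometry.ae_isSimpleTrace_sleTrace_of_le_four (κ := (8 : ℝ≥0) / 3))
    (htr : tendsto_norm_sleTrace_atTop) (hswallow : sle_swallowingTime_ofReal_eq_firstHit)
    (hA : IsSmoothHull A) (hA' : IsPlusHull A ∨ IsMinusHull A)
    {Φ : ConformalEquiv (upperHalfPlaneSet \ A) upperHalfPlaneSet} (hΦ : IsRestrictionMap A Φ)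
    {d : ℝ} (hd : HasRestrictionDeriv A Φ d) :
    Process.preWienerMeasure {ω | Disjoint (range (sleTrace ((8 : ℝ≥0) / 3) ω)) A} =
      ENNReal.ofReal (d ^ ((5 : ℝ) / 8)) := by
  have hAs : IsStarHull A := hA'.elim (fun h ↦ h.1) (fun h ↦ h.1)
  obtain ⟨Y, hY⟩ := hM hAs
  exact hY.measure_disjoint_eq_of_limits huniq hAs hΦ hd
    (sle_restrictionDeriv_frequently_gt_of_isPlusHull_or_isMinusHull' hgen h₆ htr hswallow hA')
    (sle_restrictionDeriv_frequently_lt_of_vanishesAtHit hgen h₆ hswallow hAs (h63 hA hAs))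

/-! ### [LSW] Thm. 6.1 for all hulls of `𝒬₊ ∪ 𝒬₋`, by smooth approximation -/


/-- **Thm. 6.1 along a smooth approximation** — as `sle_measure_disjoint_eq_of_hasSmoothApprox`
(`SLERestrictionSmooth`), with Lemma 6.2 supplied by its proof.
[cite: LawlerSchrammWerner2003Restriction, proof of Thm. 6.1 (§6) with Prop. 3.3 (4) ⇒ (3) and Lemma 2.1] -/
theorem sle_measure_disjoint_eq_of_hasSmoothApprox' [Fact Process.isProjectiveLimit_preWienerMeasure]
    (huniq : IsStarHull.existsUnique_isRestrictionMap) (hex : IsStarHull.exists_hasRestrictionDeriv)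
    (hM : sle_exists_isRestrictionMartingale)
    (h63 : IsSmoothHull.restrictionDerivVanishesAtHit)
    (hgen : HasSLETrace ((8 : ℝ≥0) / 3))
    (h₆ : RandomPlanarGeometry.ae_isSimpleTrace_sleTrace_of_le_four (κ := (8 : ℝ≥0) / 3))
    (htr : tendsto_norm_sleTrace_atTop) (hswallow : sle_swallowingTime_ofReal_eq_firstHit)
    (happ : HasSmoothApprox A)
    {Φ : ConformalEquiv (upperHalfPlaneSet \ A) upperHalfPlaneSet} (hΦ : IsRestrictionMap A Φ)
    {d : ℝ} (hd : HasRestrictionDeriv A Φ d) :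
    Process.preWienerMeasure {ω | Disjoint (range (sleTrace ((8 : ℝ≥0) / 3) ω)) A} =
      ENNReal.ofReal (d ^ ((5 : ℝ) / 8)) := by
  obtain ⟨J, F, hJs, hJpm, hJm, hJi, hAF, hFA, h0F, hconv⟩ := happ
  have hJst : ∀ n, IsStarHull (J n) := fun n ↦ (hJpm n).elim (fun h ↦ h.1) (fun h ↦ h.1)
  -- restriction data of the `J n`
  have hdata : ∀ n, ∃ (Ψ : ConformalEquiv (upperHalfPlaneSet \ J n) upperHalfPlaneSet) (e : ℝ),
      IsRestrictionMap (J n) Ψ ∧ HasRestrictionDeriv (J n) Ψ e := fun n ↦ by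
    obtain ⟨Ψ, hΨ, -⟩ := huniq (hJst n)
    obtain ⟨e, -, -, he⟩ := hex (hJst n) hΨ
    exact ⟨Ψ, e, hΨ, he⟩
  choose Ψ dn hΨ hdn using hdata
  have hlim : Tendsto dn atTop (𝓝 d) := hconv Φ Ψ d dn hΦ hd hΨ hdn
  -- the increasing events `{γ ∩ J n = ∅}`
  set γ : (ℝ≥0 → ℝ) → ℝ≥0 → ℂ := fun ω ↦ sleTrace ((8 : ℝ≥0) / 3) ω with hγdef
  set E : ℕ → Set (ℝ≥0 → ℝ) := fun n ↦ {ω | Disjoint (range (γ ω)) (J n)} with hE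
  have hEn : ∀ n, Process.preWienerMeasure (E n) = ENNReal.ofReal (dn n ^ ((5 : ℝ) / 8)) := fun n ↦
    sle_measure_disjoint_eq_of_isSmoothHull' huniq hM h63 hgen h₆ htr hswallow (hJs n) (hJpm n)
      (hΨ n) (hdn n)
  have hmono : Monotone E := fun m n hmn ω hω ↦ Disjoint.mono_right (hJm hmn) hω
  have h1 : Tendsto (Process.preWienerMeasure ∘ E) atTop (𝓝 (Process.preWienerMeasure (⋃ n, E n))) :=
    tendsto_measure_iUnion_atTop hmono
  have h2 : Tendsto (Process.preWienerMeasure ∘ E) atTop (𝓝 (ENNReal.ofReal (d ^ ((5 : ℝ) / 8)))) := by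
    have : Process.preWienerMeasure ∘ E = fun n ↦ ENNReal.ofReal (dn n ^ ((5 : ℝ) / 8)) := funext hEn
    rw [this]
    exact ENNReal.tendsto_ofReal (hlim.rpow_const (Or.inr (by norm_num)))
  have hU : Process.preWienerMeasure (⋃ n, E n) = ENNReal.ofReal (d ^ ((5 : ℝ) / 8)) :=
    tendsto_nhds_unique h1 h2
  -- `{γ ∩ A = ∅} = ⋃ₙ {γ ∩ J n = ∅}` almost surely
  have hκ0 : (0 : ℝ≥0) < 8 / 3 := by positivity
  have hκ4 : (8 : ℝ≥0) / 3 ≤ 4 := by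
    rw [div_le_iff₀ (by norm_num : (0 : ℝ≥0) < 3)]
    norm_num
  have hae : {ω | Disjoint (range (γ ω)) A} =ᵐ[Process.preWienerMeasure] ⋃ n, E n := by
    refine Filter.eventuallyEq_set.2 ?_
    filter_upwards [ae_isGeneratedByCurve_sleTrace hgen, h₆ hκ0 hκ4, htr hκ0] with ω hgenω hsω htrω
    simp only [mem_setOf_eq, mem_iUnion, hE]
    constructor
    · intro hω
      have h00 : γ ω 0 = 0 := by
        show sleTrace ((8 : ℝ≥0) / 3) ω 0 = 0
        rw [hgenω.apply_zero, sleDriving_zero, Complex.ofReal_zero]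
      exact exists_disjoint_of_disjoint_of_iInter_eq hgenω.continuous h00 hsω htrω
        (fun n ↦ (hJst n).isBoundedHull.isClosed) (hJst 0).isBoundedHull.1 hJm hJi hFA h0F hω
    · rintro ⟨n, hn⟩
      exact hn.mono_right (hAF.trans (hJi ▸ iInter_subset J n))
  rw [measure_congr hae, hU]

/-- **[LSW] Thm. 6.1 for every `A ∈ 𝒬₊ ∪ 𝒬₋`** — as `sle_measure_disjoint_eq_of_isPlusHull_or_isMinusHull`
(`SLERestrictionSmooth`), with Lemma 6.2 supplied by its proof.
[cite: LawlerSchrammWerner2003Restriction, Thm. 6.1 and its proof (§6), one-sided hulls] -/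
theorem sle_measure_disjoint_eq_of_isPlusHull_or_isMinusHull' [Fact Process.isProjectiveLimit_preWienerMeasure]
    (huniq : IsStarHull.existsUnique_isRestrictionMap) (hex : IsStarHull.exists_hasRestrictionDeriv)
    (hM : sle_exists_isRestrictionMartingale)
    (h63 : IsSmoothHull.restrictionDerivVanishesAtHit)
    (h21 : IsPlusHull.exists_antitone_isSmoothHull) (hgen : HasSLETrace ((8 : ℝ≥0) / 3))
    (h₆ : RandomPlanarGeometry.ae_isSimpleTrace_sleTrace_of_le_four (κ := (8 : ℝ≥0) / 3))
    (htr : tendsto_norm_sleTrace_atTop) (hswallow : sle_swallowingTime_ofReal_eq_firstHit)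
    (hA : IsPlusHull A ∨ IsMinusHull A)
    {Φ : ConformalEquiv (upperHalfPlaneSet \ A) upperHalfPlaneSet} (hΦ : IsRestrictionMap A Φ)
    {d : ℝ} (hd : HasRestrictionDeriv A Φ d) :
    Process.preWienerMeasure {ω | Disjoint (range (sleTrace ((8 : ℝ≥0) / 3) ω)) A} =
      ENNReal.ofReal (d ^ ((5 : ℝ) / 8)) := by
  rcases A.eq_empty_or_nonempty with rfl | hne
  · -- the empty hull
    have hd1 : d = 1 :=
      HasRestrictionDeriv.eq_of_isRestrictionMap huniq isStarHull_empty isRestrictionMap_empty hΦ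
        hasRestrictionDeriv_empty hd
    subst hd1
    simp [Real.one_rpow]
  · exact sle_measure_disjoint_eq_of_hasSmoothApprox' huniq hex hM h63 hgen h₆ htr hswallow
      (hasSmoothApprox_of_plus_or_minus h21 hA hne) hΦ hd


end Smooth

/-! ### [LSW] Thm. 6.1 (two-sided assembly), without Lemma 6.2 as a hypothesis -/

/-- **[LSW] Lemma 6.2 for SLE_{8/3} and a two-sided hull `A = A₊ ∪ A₋`** — as
`sle_restrictionDeriv_frequently_gt_of_union` (`SLERestrictionSlidHull`), with Lemma 6.2 for the two
parts supplied by the proved simple-curve forms (`restrictionDeriv_exitTime_gt_simple_holds`,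
`restrictionDeriv_exitTime_gt_of_isMinusHull_simple`).
[cite: LawlerSchrammWerner2003Restriction, Lemma 6.2 and proof of Thm. 6.1 (§6), with Prop. 4.1] -/
theorem sle_restrictionDeriv_frequently_gt_of_union'
    (huniq : IsStarHull.existsUnique_isRestrictionMap)
    (hgen : HasSLETrace ((8 : ℝ≥0) / 3))
    (h₆ : RandomPlanarGeometry.ae_isSimpleTrace_sleTrace_of_le_four (κ := (8 : ℝ≥0) / 3))
    (htr : tendsto_norm_sleTrace_atTop) (hswallow : sle_swallowingTime_ofReal_eq_firstHit)
    {A Ap Am : Set ℂ} (hA : IsStarHull A) (hAp : IsPlusHull Ap) (hAm : IsMinusHull Am)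
    (hunion : Ap ∪ Am = A) : sle_restrictionDeriv_frequently_gt A := by
  have hκ0 : (0 : ℝ≥0) < 8 / 3 := by positivity
  have hκ4 : (8 : ℝ≥0) / 3 ≤ 4 := by
    rw [div_le_iff₀ (by norm_num : (0 : ℝ≥0) < 3)]
    norm_num
  obtain ⟨Φ, hΦ, -⟩ := huniq hA
  obtain ⟨Φp, hΦp, -⟩ := huniq hAp.1
  obtain ⟨Φm, hΦm, -⟩ := huniq hAm.1
  filter_upwards [ae_isGeneratedByCurve_sleTrace hgen, h₆ hκ0 hκ4, htr hκ0] with ω hgenω hsω htrω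
    hT ε hε
  set W := sleDriving ((8 : ℝ≥0) / 3) ω with hWdef
  have hW : Continuous W := continuous_sleDriving _ ω
  have hW0 : W 0 = 0 := sleDriving_zero _ _
  have hγA : Disjoint (range (sleTrace ((8 : ℝ≥0) / 3) ω)) A := firstHit_eq_top_iff_disjoint.1 hT
  have hγp : Disjoint (range (sleTrace ((8 : ℝ≥0) / 3) ω)) Ap :=
    hγA.mono_right (hunion ▸ subset_union_left)
  have hγm : Disjoint (range (sleTrace ((8 : ℝ≥0) / 3) ω)) Am :=
    hγA.mono_right (hunion ▸ subset_union_right)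
  have hε2 : 0 < ε / 2 := by linarith
  obtain ⟨r₁, hr₁⟩ := Loewner.restrictionDeriv_exitTime_gt_simple_holds hW hW0 hgenω hsω hAp
    (disjoint_closedHull hswallow hgenω hsω hγp) (ε / 2) hε2
  obtain ⟨r₂, hr₂⟩ := Loewner.restrictionDeriv_exitTime_gt_of_isMinusHull_simple hW hW0 hgenω hsω hAm
    (disjoint_closedHull hswallow hgenω hsω hγm) hε2
  rw [frequently_atTop]
  intro a
  obtain ⟨r, hr, t, hat, ht⟩ := exists_isExitTime_ge hswallow hgenω hsω htrω a (max r₁ r₂)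
  refine ⟨t, hat, fun Ψ e hΨ he ↦ ?_⟩
  -- the three slid hulls are `*`-hulls, the slid hull of `A` being the union of the others
  have hdj : ∀ {B : Set ℂ}, Disjoint (range (sleTrace ((8 : ℝ≥0) / 3) ω)) B →
      Disjoint (sleTrace ((8 : ℝ≥0) / 3) ω '' Icc 0 t) B := fun h ↦
    h.mono_left (image_subset_range _ _)
  have hB : IsStarHull (Loewner.slidHull W A t) := hgenω.isStarHull_slidHull hW hW0 hsω hA hΦ (hdj hγA)
  have hBp : IsStarHull (Loewner.slidHull W Ap t) :=
    hgenω.isStarHull_slidHull hW hW0 hsω hAp.1 hΦp (hdj hγp)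
  have hBm : IsStarHull (Loewner.slidHull W Am t) :=
    hgenω.isStarHull_slidHull hW hW0 hsω hAm.1 hΦm (hdj hγm)
  have hBunion : Loewner.slidHull W Ap t ∪ Loewner.slidHull W Am t = Loewner.slidHull W A t := by
    rw [← Loewner.slidHull_union, hunion]
  -- restriction data of the slid parts, and Lemma 6.2 for each
  obtain ⟨Ψp, hΨp, -⟩ := huniq hBp
  obtain ⟨ep, -, -, hep⟩ := IsStarHull.exists_hasRestrictionDeriv_holds hBp hΨp
  obtain ⟨Ψm, hΨm, -⟩ := huniq hBm
  obtain ⟨em, -, -, hem⟩ := IsStarHull.exists_hasRestrictionDeriv_holds hBm hΨm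
  have h1 : 1 - ε / 2 < ep := hr₁ r ((le_max_left _ _).trans hr) t ht Ψp ep hΨp hep
  have h2 : 1 - ε / 2 < em := hr₂ r ((le_max_right _ _).trans hr) t ht Ψm em hΨm hem
  -- subadditivity
  have hsub := HasRestrictionDeriv.one_sub_le_add hBp hBm hB hBunion hΨp hΨm hΨ hep hem he
  linarith

/-! ### Assembly: `sle_restriction_eightThirds` from the printed facts -/


/-- **[LSW] Thm. 6.1 (`sle_restriction_eightThirds`) from its ingredients** — as
`sle_restriction_eightThirds_of_facts` (`SLERestrictionSlidHull`), WITHOUT Lemma 6.2 as a hypothesis.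
[cite: LawlerSchrammWerner2003Restriction, Thm. 6.1 and its proof (§6)] -/
theorem sle_restriction_eightThirds_of_facts' [Fact Process.isProjectiveLimit_preWienerMeasure]
    (huniq : IsStarHull.existsUnique_isRestrictionMap) (hex : IsStarHull.exists_hasRestrictionDeriv)
    (hM : sle_exists_isRestrictionMartingale)
    (h63 : IsSmoothHull.restrictionDerivVanishesAtHit)
    (h21 : IsPlusHull.exists_antitone_isSmoothHull)
    (hdom : ∀ {A A' : Set ℂ}, IsStarHull A → IsStarHull A' → A' ⊆ A →
      sle_restrictionDeriv_dominated A A')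
    (hgen : HasSLETrace ((8 : ℝ≥0) / 3))
    (h₆ : RandomPlanarGeometry.ae_isSimpleTrace_sleTrace_of_le_four (κ := (8 : ℝ≥0) / 3))
    (htr : tendsto_norm_sleTrace_atTop) (hswallow : sle_swallowingTime_ofReal_eq_firstHit)
    (hmeas : ∀ t : ℝ≥0, AEMeasurable (fun ω ↦ sleTrace ((8 : ℝ≥0) / 3) ω t) Process.preWienerMeasure) :
    sle_restriction_eightThirds := by
  intro A hA Φ hΦ d hd
  have one_sided : ∀ {B : Set ℂ}, IsPlusHull B ∨ IsMinusHull B →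
      ∀ {Ψ : ConformalEquiv (upperHalfPlaneSet \ B) upperHalfPlaneSet}, IsRestrictionMap B Ψ →
        ∀ {e : ℝ}, HasRestrictionDeriv B Ψ e →
          Process.preWienerMeasure {ω | Disjoint (range (sleTrace ((8 : ℝ≥0) / 3) ω)) B} =
            ENNReal.ofReal (e ^ ((5 : ℝ) / 8)) := fun hB _ hΨ _ he ↦
    sle_measure_disjoint_eq_of_isPlusHull_or_isMinusHull' huniq hex hM h63 h21 hgen h₆ htr
      hswallow hB hΨ he
  -- the `±`-decomposition
  have hnf := hA.isBoundedHull.isConnected_union_im_nonpos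
  obtain ⟨hP, hMi, hunion, -, -, -⟩ := hA.sidePart_decomposition hnf
  set Ap := sidePart A 1 with hAp
  set Am := sidePart A (-1) with hAm
  rcases Am.eq_empty_or_nonempty with hm0 | hnem
  · -- `A = A₊` is a `+`-hull
    have hAeq : Ap = A := by rw [← hunion, hm0, union_empty]
    exact one_sided (Or.inl (hAeq ▸ hP)) hΦ hd
  rcases Ap.eq_empty_or_nonempty with hp0 | hnep
  · -- `A = A₋` is a `−`-hull
    have hAeq : Am = A := by rw [← hunion, hp0, empty_union]
    exact one_sided (Or.inr (hAeq ▸ hMi)) hΦ hd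
  -- two-sided: data and martingales for the parts
  obtain ⟨Φp, hΦp, -⟩ := huniq hP.1
  obtain ⟨dp, -, -, hdp⟩ := hex hP.1 hΦp
  obtain ⟨Φm, hΦm, -⟩ := huniq hMi.1
  obtain ⟨dm, -, -, hdm⟩ := hex hMi.1 hΦm
  obtain ⟨Y, hY⟩ := hM hA
  obtain ⟨Yp, hYp⟩ := hM hP.1
  obtain ⟨Ym, hYm⟩ := hM hMi.1
  exact sle_measure_disjoint_eq_of_sideParts huniq hex hmeas hA hunion hP.1 hMi.1 hY hYp hYm
    (sle_restrictionDeriv_frequently_gt_of_union' huniq hgen h₆ htr hswallow hA hP hMi hunion)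
    (sle_restrictionDeriv_frequently_gt_of_isPlusHull_or_isMinusHull' hgen h₆ htr hswallow
      (Or.inl hP))
    (sle_restrictionDeriv_frequently_gt_of_isPlusHull_or_isMinusHull' hgen h₆ htr hswallow
      (Or.inr hMi))
    hΦp hdp (one_sided (Or.inl hP) hΦp hdp) hΦm hdm (one_sided (Or.inr hMi) hΦm hdm)
    (hdom hA hP.1 (hunion ▸ subset_union_left)) (hdom hA hMi.1 (hunion ▸ subset_union_right))
    hΦ hd

/-! ### [LSW] Thm. 6.1 from printed statements -/

/-- **[LSW] Thm. 6.1 (`sle_restriction_eightThirds`) from printed statements**, with Lemma 6.2 PROVED —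
as `sle_restriction_eightThirds_of_printed_facts` (`SLERestrictionSlidHull`); remaining inputs:
[LSW] Prop. 5.2/5.3 (`hM`), Lemma 6.3 (`h63`), Lemma 2.1 (`h21`, proved in the tree), `Φ_A`/`Φ'_A(0)`
(`huniq`, `hex`, proved), and the Rohde–Schramm / Lawler facts on the trace (`hgen`, `h₆`, `htr`,
`hswallow`, `hmeas`). [cite: LawlerSchrammWerner2003Restriction, Thm. 6.1 and its proof (§6)] -/
theorem sle_restriction_eightThirds_of_printed_facts' [Fact Process.isProjectiveLimit_preWienerMeasure]
    (huniq : IsStarHull.existsUnique_isRestrictionMap) (hex : IsStarHull.exists_hasRestrictionDeriv)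
    (hM : sle_exists_isRestrictionMartingale)
    (h63 : IsSmoothHull.restrictionDerivVanishesAtHit)
    (h21 : IsPlusHull.exists_antitone_isSmoothHull)
    (hgen : HasSLETrace ((8 : ℝ≥0) / 3))
    (h₆ : RandomPlanarGeometry.ae_isSimpleTrace_sleTrace_of_le_four (κ := (8 : ℝ≥0) / 3))
    (htr : tendsto_norm_sleTrace_atTop) (hswallow : sle_swallowingTime_ofReal_eq_firstHit)
    (hmeas : ∀ t : ℝ≥0, AEMeasurable (fun ω ↦ sleTrace ((8 : ℝ≥0) / 3) ω t) Process.preWienerMeasure) :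
    sle_restriction_eightThirds :=
  sle_restriction_eightThirds_of_facts' huniq hex hM h63 h21
    (fun hA hA' hsub ↦ sle_restrictionDeriv_dominated_of_subset huniq hgen h₆ hA hA' hsub)
    hgen h₆ htr hswallow hmeas

/-! ### The transposed Thm. 6.1 from six leaf facts -/

/-- **[LSW] Thm. 6.1 transposed to Dobrushin domains, from six leaf facts** — as
`IsSLELaw.hullRestriction_eightThirds_of_leaf_facts` (`HullRestrictionSLELeaf`) with Lemma 6.2
now PROVED (`Loewner.restrictionDeriv_exitTime_gt_simple_holds`): the remaining named facts are
`hasSLETrace_eight` (`h8`, only through SLE scaling in law for all `κ`),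
`hasSLETrace_of_ne_eight` (`hne`), `tendsto_norm_sleTrace_atTop` (`htr`),
`ae_isSimpleTrace_sleTrace_of_le_four` at `κ = 8/3` (`h₆`), the restriction martingale
(`hM`, [LSW] Prop. 5.2/5.3) and [LSW] Lemma 6.3 (`h63`).
[cite: LawlerSchrammWerner2003Restriction, Thm. 6.1 (p. 23) and its proof (§6), with Prop. 3.3 (p. 11)] -/
theorem IsSLELaw.hullRestriction_eightThirds_of_leaf_facts' (h8 : hasSLETrace_eight)
    (hne : hasSLETrace_of_ne_eight) (htr : tendsto_norm_sleTrace_atTop)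
    (h₆ : RandomPlanarGeometry.ae_isSimpleTrace_sleTrace_of_le_four (κ := (8 : ℝ≥0) / 3))
    (hM : sle_exists_isRestrictionMartingale) (h63 : IsSmoothHull.restrictionDerivVanishesAtHit) :
    IsSLELaw.hullRestriction_eightThirds := by
  haveI : Fact Process.isProjectiveLimit_preWienerMeasure := ⟨isProjectiveLimit_preWienerMeasure_holds⟩
  have hC : JordanDomain.exists_continuousOn_extension :=
    JordanDomain.exists_continuousOn_extension_of_jordanCurveTheorem
      Literature.Topology.PlaneTopology.JordanCurveTheorem_holds
  have hgen : HasSLETrace ((8 : ℝ≥0) / 3) := hasSLETrace h8 hne _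
  have hscale : identDistrib_sleTrace_scale := identDistrib_sleTrace_scale_of_trace_theorems h8 hne
  have h61 : sle_restriction_eightThirds :=
    sle_restriction_eightThirds_of_printed_facts' IsStarHull.existsUnique_isRestrictionMap_holds
      IsStarHull.exists_hasRestrictionDeriv_holds hM h63
      IsPlusHull.exists_antitone_isSmoothHull_holds hgen h₆ htr
      sle_swallowingTime_ofReal_eq_firstHit_holds (aemeasurable_sleTrace_holds hgen)
  exact IsSLELaw.hullRestriction_eightThirds_of_facts h61
    IsStarHull.existsUnique_isRestrictionMap_holds IsStarHull.exists_hasRestrictionDeriv_holds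
    HasRestrictionDeriv.tendsto_of_kernel_holds isSimplyConnected_of_isConnected_compl_holds
    JordanDomain.isSimplyConnected_holds Literature.Topology.PlaneTopology.JordanCurveTheorem_holds
    Literature.Topology.PlaneTopology.JordanArcSeparation_holds exists_conformalEquiv_ball_holds hC
    hgen h₆ htr (IsSLECurve.map_eq_of_sleScaling hscale) aemeasurable_sleTrace_holds

/-! ### Uniqueness in law of chordal SLE_κ at one `κ`, and the transposed Thm. 6.1 from five leaf facts -/

/-- **Independence of the uniformizing map at a single `κ`.** Two chordal SLE_κ random curves of
the same Dobrushin domain have the same law as soon as SLE_κ (this `κ`) is generated by a curve: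
the statement of `IsSLECurve.map_eq` at one `κ`, by the proof of `IsSLECurve.map_eq_of_facts`
(`SLEProofs`) with SLE scaling in law taken at this `κ` only
(`identDistrib_sleTrace_scale_of_hasSLETrace`, Lawler (2005), Prop. 6.5, proved in the tree from
Brownian scaling for every `κ` with `HasSLETrace κ`), uniqueness of chordal uniformizing maps up to
dilation and Carathéodory continuity of the boundary extension (both theorems of the tree given the
Jordan curve theorem). Lawler (2005), §6.1 (paragraph after Remark 6.7). [cite: Lawler2005, §6.1] -/
theorem IsSLECurve.map_eq_of_hasSLETrace {κ : ℝ≥0} (hκt : HasSLETrace κ) {D : DobrushinDomain}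
    {Γ Γ' : (ℝ≥0 → ℝ) → CurveClass ℂ} (hΓ : IsSLECurve κ D Γ) (hΓ' : IsSLECurve κ D Γ') :
    Process.preWienerMeasure.map Γ = Process.preWienerMeasure.map Γ' := by
  have hC : JordanDomain.exists_continuousOn_extension :=
    JordanDomain.exists_continuousOn_extension_of_jordanCurveTheorem
      Literature.Topology.PlaneTopology.JordanCurveTheorem_holds
  have h₁ : MarkedDomain.IsChordalUniformizing.exists_eq_trans_smul :=
    MarkedDomain.IsChordalUniformizing.exists_eq_trans_smul_of_disc hC
  have h₇ : JordanDomain.continuousOn_boundaryExtension :=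
    JordanDomain.continuousOn_boundaryExtension_of_disc hC
  obtain ⟨-, φ, hφ, hae⟩ := hΓ
  obtain ⟨-, φ', hφ', hae'⟩ := hΓ'
  obtain ⟨r, hr, hEq⟩ := h₁ hφ hφ'
  have hΦm : Measurable φ.truncatedBoundaryExtension :=
    ConformalEquiv.measurable_truncatedBoundaryExtension h₇ D.toJordanDomain φ
  have hΨ : Measurable (compactifiedClass φ.truncatedBoundaryExtension (D.pt 1)) :=
    measurable_compactifiedClass hΦm _
  -- the dilation factor as an element of `ℝ≥0`
  obtain ⟨rn, hrn0, hrn⟩ : ∃ rn : ℝ≥0, rn ≠ 0 ∧ (rn : ℝ) = r :=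
    ⟨r.toNNReal, (Real.toNNReal_pos.2 hr).ne', Real.coe_toNNReal r hr.le⟩
  have hID := identDistrib_sleTrace_scale_of_hasSLETrace hκt hrn0
  -- a.s. `Γ = Ψ ∘ trace`
  have hΓ₁ : Γ =ᵐ[Process.preWienerMeasure]
      compactifiedClass φ.truncatedBoundaryExtension (D.pt 1) ∘ fun ω ↦ sleTrace κ ω := by
    filter_upwards [hae] with ω ⟨hgen, c, hΓc, hc⟩
    rw [Function.comp_apply, hΓc]
    exact (IsCompactifiedImage.compactifiedClass_eq (hc.congr_left fun t ↦
      φ.truncatedBoundaryExtension_eq (hgen.im_nonneg t))).symm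
  -- a.s. `Γ' = Ψ ∘ (rescaled trace)`
  have hΓ₂ : Γ' =ᵐ[Process.preWienerMeasure]
      compactifiedClass φ.truncatedBoundaryExtension (D.pt 1) ∘
        fun ω t ↦ (rn : ℂ) * sleTrace κ ω (t / rn ^ 2) := by
    filter_upwards [hae'] with ω ⟨hgen, c, hΓc, hc⟩
    rw [Function.comp_apply, hΓc]
    have hc' : IsCompactifiedImage φ.truncatedBoundaryExtension
        (fun t ↦ (rn : ℂ) * sleTrace κ ω (rn ^ 2 * t / rn ^ 2)) (D.pt 1) c := by
      refine ⟨fun s hs ↦ ?_, hc.2⟩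
      have him : 0 ≤ ((rn : ℂ) * sleTrace κ ω (rayParam s)).im := by
        rw [Complex.im_ofReal_mul]
        exact mul_nonneg rn.2 (hgen.im_nonneg _)
      rw [hc.1 s hs, φ.boundaryExtension_eq_of_eqOn_smul_trans φ' hr hEq]
      beta_reduce
      rw [mul_div_cancel_left₀ _ (pow_ne_zero 2 hrn0), φ.truncatedBoundaryExtension_eq him,
        Complex.real_smul, ← hrn]
    have key := IsCompactifiedImage.of_comp_mul
      (γ := fun t ↦ (rn : ℂ) * sleTrace κ ω (t / rn ^ 2)) (pow_ne_zero 2 hrn0) hc'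
    rw [key.compactifiedClass_eq, CurveClass.mk_reparam]
  -- push the identity in law through the measurable functional
  calc Process.preWienerMeasure.map Γ
      = Process.preWienerMeasure.map
          (compactifiedClass φ.truncatedBoundaryExtension (D.pt 1) ∘ fun ω ↦ sleTrace κ ω) :=
        Measure.map_congr hΓ₁
    _ = (Process.preWienerMeasure.map fun ω ↦ sleTrace κ ω).map
          (compactifiedClass φ.truncatedBoundaryExtension (D.pt 1)) :=
        (AEMeasurable.map_map_of_aemeasurable hΨ.aemeasurable hID.aemeasurable_fst).symm
    _ = (Process.preWienerMeasure.map fun ω t ↦ (rn : ℂ) * sleTrace κ ω (t / rn ^ 2)).map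
          (compactifiedClass φ.truncatedBoundaryExtension (D.pt 1)) := by
        rw [hID.map_eq]
    _ = Process.preWienerMeasure.map
          (compactifiedClass φ.truncatedBoundaryExtension (D.pt 1) ∘
            fun ω t ↦ (rn : ℂ) * sleTrace κ ω (t / rn ^ 2)) :=
        AEMeasurable.map_map_of_aemeasurable hΨ.aemeasurable hID.aemeasurable_snd
    _ = Process.preWienerMeasure.map Γ' := (Measure.map_congr hΓ₂).symm

/-- **[LSW] Thm. 6.1 transposed to Dobrushin domains, from five leaf facts** — as
`IsSLELaw.hullRestriction_eightThirds_of_leaf_facts'`, without the SLE₈ trace theorem: by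
`IsSLELaw.hullRestriction_eightThirds_of_facts_at` (`HullRestrictionSLE`) the transposition needs
uniqueness in law of chordal SLE_κ only at `κ = 8/3`, which is `IsSLECurve.map_eq_of_hasSLETrace`
from `HasSLETrace (8/3)` (`hne`). The remaining named facts are `hasSLETrace_of_ne_eight` (`hne`,
Rohde–Schramm (2005) Thm. 5.1), `tendsto_norm_sleTrace_atTop` (`htr`, RS05 Thm. 7.1),
`ae_isSimpleTrace_sleTrace_of_le_four` at `κ = 8/3` (`h₆`, RS05 Thm. 6.1), the restriction
martingale (`hM`, [LSW] Prop. 5.2/5.3) and [LSW] Lemma 6.3 (`h63`).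
[cite: LawlerSchrammWerner2003Restriction, Thm. 6.1 (p. 23) and its proof (§6), with Prop. 3.3 (p. 11)] -/
theorem IsSLELaw.hullRestriction_eightThirds_of_leaf_facts'' (hne : hasSLETrace_of_ne_eight)
    (htr : tendsto_norm_sleTrace_atTop)
    (h₆ : RandomPlanarGeometry.ae_isSimpleTrace_sleTrace_of_le_four (κ := (8 : ℝ≥0) / 3))
    (hM : sle_exists_isRestrictionMartingale) (h63 : IsSmoothHull.restrictionDerivVanishesAtHit) :
    IsSLELaw.hullRestriction_eightThirds := by
  haveI : Fact Process.isProjectiveLimit_preWienerMeasure := ⟨isProjectiveLimit_preWienerMeasure_holds⟩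
  have hC : JordanDomain.exists_continuousOn_extension :=
    JordanDomain.exists_continuousOn_extension_of_jordanCurveTheorem
      Literature.Topology.PlaneTopology.JordanCurveTheorem_holds
  have hgen : HasSLETrace ((8 : ℝ≥0) / 3) := hne (by norm_num)
  have h61 : sle_restriction_eightThirds :=
    sle_restriction_eightThirds_of_printed_facts' IsStarHull.existsUnique_isRestrictionMap_holds
      IsStarHull.exists_hasRestrictionDeriv_holds hM h63
      IsPlusHull.exists_antitone_isSmoothHull_holds hgen h₆ htr
      sle_swallowingTime_ofReal_eq_firstHit_holds (aemeasurable_sleTrace_holds hgen)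
  exact IsSLELaw.hullRestriction_eightThirds_of_facts_at h61
    IsStarHull.existsUnique_isRestrictionMap_holds IsStarHull.exists_hasRestrictionDeriv_holds
    HasRestrictionDeriv.tendsto_of_kernel_holds isSimplyConnected_of_isConnected_compl_holds
    JordanDomain.isSimplyConnected_holds Literature.Topology.PlaneTopology.JordanCurveTheorem_holds
    Literature.Topology.PlaneTopology.JordanArcSeparation_holds exists_conformalEquiv_ball_holds hC
    hgen h₆ htr (fun hΓ hΓ' ↦ IsSLECurve.map_eq_of_hasSLETrace hgen hΓ hΓ') aemeasurable_sleTrace_holds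

end Literature.Probability.RandomPlanarGeometry

end
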